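import Literature.NumberTheory.EllipticCurves.H1CorestrictionIndexTwo
import Mathlib.Algebra.Group.Nat.Even
import HarnessLib

/-!
# Route `SignedLowerHalves`, crux L `SmallImageLowerHalfBothSigns` (stmt-BirchSwinnertonDyer-23599), line `rtt_w3` v10 — brick D1 of COUNT
# (memo `Lines/rtt_w3-BRIEF-E1b-g6.md` §9.3, route D «descent, not Shapiro»): along an open normal subgroup `N ≤ G` of index `2`
# (`G = N ⊔ N c`), restriction `H¹(G, M) → H¹(N, M)` is INJECTIVE on classes of odd order and its image among such classes is EXACTLY
# the `c_*`-invariants — the quadratic step `Γ_{ℚ_n} ⊃ Γ_{K_n}` of the residual comparison `W[p] ⊗ k_S ↔ k_S(θ̄)` at odd `p`.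

LEAD `cruxlead-stmt-BirchSwinnertonDyer-23599` g6 (cell `bsd-ssimc`; `--supports stmt-BirchSwinnertonDyer-23599 --as helper`). THEOREMS ONLY (no definition,
no named fact, no instance, no `sorry`); generic continuous group cohomology on the tree's `discreteH1` / `subgroupH1` / `conjH1` with the landed
index-`2` transfer `corH1` (`Literature/NumberTheory/EllipticCurves/H1CorestrictionIndexTwo.lean`: `cor ∘ res = 2`, `res ∘ cor = 1 + c_*`,
`c_* ∘ res = res`). BSD / crux L / COUNT are NOT proved here.

WHAT (`N ≤ G` open normal, `c ∈ G` with `∀ b, Xor (b c⁻¹ ∈ N) (b ∈ N)`, `M` a discrete `G`-module with continuous orbit maps):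
* `eq_zero_of_two_nsmul_of_odd_nsmul` — an element killed by `2` and by an odd number is `0`; `nsmul_oneCocycleClass_eq_zero_of_forall` /
  `nsmul_eq_zero_of_forall_smul_eq_zero` — if `m • M = 0` then `m` kills every class of `H¹(G, M)` (resp. `H¹(N, M)`).
* ★ `resSubgroupH1_injective_of_odd` — if every class of `H¹(G, M)` is killed by some odd number, `res : H¹(G, M) → H¹(N, M)` is injective
  (`cor (res η) = 2η`).
* ★ `mem_range_resSubgroupH1_iff_conjH1_eq` — for a class `ξ ∈ H¹(N, M)` killed by an odd number: `ξ ∈ range res ↔ c_* ξ = ξ`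
  (`c_* ∘ res = res`; conversely `res (cor ξ) = ξ + c_* ξ = 2ξ` and `2` is invertible on `ξ`).
* `resSubgroupH1_injective_of_prime_ne_two`, `mem_range_resSubgroupH1_iff_of_prime_ne_two` — the forms COUNT uses: `M` killed by an odd prime `p`
  (residual Galois modules `W[p] ⊗ k_S`, `k_S(θ̄)`).

References: [SerreGaloisCohomology1997] I §2.4 (res, cor, `cor ∘ res = (G:N)`, Prop. 9), I §2.6 (b) (inflation–restriction); [NeukirchSchmidtWingberg2008] (1.6.7).
-/

set_option autoImplicit false
set_option linter.dupNamespace false -- D-0017: single-problem summit, the namespace repeats the problem name by design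
noncomputable section

open scoped Classical

universe u

namespace Summit.BirchSwinnertonDyer.BirchSwinnertonDyer.Theorems.SmallImageCharSignedSelmer

open Literature.NumberTheory.EllipticCurves Literature.NumberTheory.GaloisRepresentations

/-! ## §1. Arithmetic of `2` against odd torsion -/

/-- An element of an additive group killed by `2` and by an odd number is `0`. [folklore] -/
theorem eq_zero_of_two_nsmul_of_odd_nsmul {A : Type*} [AddCommGroup A] {x : A} {m : ℕ} (hm : Odd m)
    (h2 : 2 • x = 0) (hmx : m • x = 0) : x = 0 := by
  obtain ⟨k, rfl⟩ := hm
  rw [add_nsmul, one_nsmul, mul_nsmul, h2, nsmul_zero, zero_add] at hmx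
  exact hmx

/-- If `2 • y` lies in a subgroup and `y` is killed by an odd number then `y` lies in the subgroup (`y = (2k+1)y − k(2y)`). [folklore] -/
theorem mem_of_two_nsmul_mem_of_odd_nsmul {A : Type*} [AddCommGroup A] (B : AddSubgroup A) {y : A} {m : ℕ} (hm : Odd m)
    (h2 : 2 • y ∈ B) (hmy : m • y = 0) : y ∈ B := by
  obtain ⟨k, rfl⟩ := hm
  have hy : y = -(k • (2 • y)) := by
    rw [add_nsmul, one_nsmul, mul_nsmul] at hmy
    exact eq_neg_of_add_eq_zero_right hmy
  rw [hy]
  exact B.neg_mem (B.nsmul_mem h2 k)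

/-! ## §2. Torsion of `H¹` classes from torsion of the coefficients -/

section Torsion

variable {H : Type u} [Group H] [TopologicalSpace H] [IsTopologicalGroup H]
  {M : Type u} [AddCommGroup M] [DistribMulAction H M] [TopologicalSpace M] [DiscreteTopology M]

/-- If `m` kills the coefficients then `m` kills every class of `H¹(H, M)` (pointwise on cocycles). [folklore] -/
theorem nsmul_eq_zero_of_forall_smul_eq_zero {m : ℕ} (hm : ∀ a : M, m • a = 0) (η : discreteH1 H M) : m • η = 0 := by
  obtain ⟨f, rfl⟩ := oneCocycleClass_surjective _ η
  have hf : m • f = 0 := by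
    apply Subtype.ext
    ext x
    rw [nsmul_apply_val, hm]
    rfl
  rw [← classHom_apply, ← map_nsmul, hf, map_zero]

end Torsion

/-! ## §3. Restriction along an index-`2` open normal subgroup: injectivity and image on odd-torsion classes -/

section IndexTwo

variable {G : Type u} [Group G] [TopologicalSpace G] [IsTopologicalGroup G] {N : Subgroup G} [N.Normal] {c : G}
  {M : Type u} [AddCommGroup M] [DistribMulAction G M] [TopologicalSpace M] [DiscreteTopology M]

/-- ★ **Restriction to an index-`2` open normal subgroup is injective on classes of odd order**: if `res η = 0` then `2η = cor (res η) = 0`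
(`corH1_resSubgroupH1`), and `η` is also killed by an odd number. [cite: SerreGaloisCohomology1997, I §2.4 Prop. 9] -/
theorem resSubgroupH1_injective_of_odd (hN : IsOpen (N : Set G)) (hM : ∀ m : M, Continuous fun g : G ↦ g • m)
    (hc : ∀ b : G, Xor (b * c⁻¹ ∈ N) (b ∈ N))
    (hodd : ∀ η : discreteH1 G M, ∃ m : ℕ, Odd m ∧ m • η = 0) :
    Function.Injective (resSubgroupH1 N M) := by
  rw [injective_iff_map_eq_zero]
  intro η hη
  obtain ⟨m, hm, hmη⟩ := hodd η
  have h2 : 2 • η = 0 := by rw [← corH1_resSubgroupH1 hN hM hc η, hη, map_zero]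
  exact eq_zero_of_two_nsmul_of_odd_nsmul hm h2 hmη

/-- ★ **The image of restriction on odd-torsion classes is the `c_*`-invariants**: for `ξ ∈ H¹(N, M)` killed by an odd number,
`ξ ∈ range (res : H¹(G, M) → H¹(N, M)) ↔ c_* ξ = ξ` (`⇒`: `c_* ∘ res = res`; `⇐`: `res (cor ξ) = ξ + c_* ξ = 2ξ` and `2` is invertible on `ξ`).
[cite: SerreGaloisCohomology1997, I §2.6 (b)] [cite: NeukirchSchmidtWingberg2008, (1.6.7)] -/
theorem mem_range_resSubgroupH1_iff_conjH1_eq (hN : IsOpen (N : Set G)) (hM : ∀ m : M, Continuous fun g : G ↦ g • m)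
    (hc : ∀ b : G, Xor (b * c⁻¹ ∈ N) (b ∈ N))
    {ξ : subgroupH1 N M} (hξ : ∃ m : ℕ, Odd m ∧ m • ξ = 0) :
    ξ ∈ (resSubgroupH1 N M).range ↔ conjH1 N M c ξ = ξ := by
  constructor
  · rintro ⟨η, rfl⟩
    exact conjH1_resSubgroupH1 N hM c η
  · intro hfix
    obtain ⟨m, hm, hmξ⟩ := hξ
    have h2 : 2 • ξ ∈ (resSubgroupH1 N M).range := by
      refine ⟨corH1 hN hM hc ξ, ?_⟩
      rw [resSubgroupH1_corH1 hN hM hc ξ, hfix, two_nsmul]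
    exact mem_of_two_nsmul_mem_of_odd_nsmul _ hm h2 hmξ

/-- **COUNT's form (injectivity)**: `M` killed by an odd prime `p` (a residual Galois module `W[p] ⊗ k_S` or `k_S(θ̄)`): `res` is injective.
[cite: SerreGaloisCohomology1997, I §2.4 Prop. 9] -/
theorem resSubgroupH1_injective_of_prime_ne_two (hN : IsOpen (N : Set G)) (hM : ∀ m : M, Continuous fun g : G ↦ g • m)
    (hc : ∀ b : G, Xor (b * c⁻¹ ∈ N) (b ∈ N)) {p : ℕ} (hp : p.Prime) (hp2 : p ≠ 2) (hpM : ∀ a : M, p • a = 0) :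
    Function.Injective (resSubgroupH1 N M) :=
  resSubgroupH1_injective_of_odd hN hM hc fun η ↦ ⟨p, hp.odd_of_ne_two hp2, nsmul_eq_zero_of_forall_smul_eq_zero hpM η⟩

/-- **COUNT's form (image)**: `M` killed by an odd prime `p`: `ξ ∈ range res ↔ c_* ξ = ξ` for every `ξ ∈ H¹(N, M)`.
[cite: SerreGaloisCohomology1997, I §2.6 (b)] -/
theorem mem_range_resSubgroupH1_iff_of_prime_ne_two (hN : IsOpen (N : Set G)) (hM : ∀ m : M, Continuous fun g : G ↦ g • m)
    (hc : ∀ b : G, Xor (b * c⁻¹ ∈ N) (b ∈ N)) {p : ℕ} (hp : p.Prime) (hp2 : p ≠ 2) (hpM : ∀ a : M, p • a = 0)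
    (ξ : subgroupH1 N M) : ξ ∈ (resSubgroupH1 N M).range ↔ conjH1 N M c ξ = ξ :=
  mem_range_resSubgroupH1_iff_conjH1_eq hN hM hc
    ⟨p, hp.odd_of_ne_two hp2, nsmul_eq_zero_of_forall_smul_eq_zero (H := N) (fun a ↦ hpM a) ξ⟩

end IndexTwo

end Summit.BirchSwinnertonDyer.BirchSwinnertonDyer.Theorems.SmallImageCharSignedSelmer

end
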